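import Literature.Analysis.FluidPDE.SelfSimilarEulerOutgoingAnalytic
import Literature.Analysis.FluidPDE.SelfSimilarEulerOutgoingExclusionTools
import Literature.Analysis.FluidPDE.HarmonicLiouvilleSublinear
import HarnessLib

/-!
# Outgoing self-similar Euler profiles have `γ ≥ ½` — Constantin–Ignatova–Vicol 2026, Thm 3.10,
# discharged WITHOUT the analyticity hypothesis

Analysis/FluidPDE proofs file (theorems only; no definitions, no named facts). It DISCHARGES the
named fact `Literature.Analysis.FluidPDE.CIV2026_half_le_of_isLocallyOutgoing_of_analyticAt`
(P. Constantin, M. Ignatova, V. Vicol, *On putative self-similarity for incompressible 3D Euler*,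
arXiv:2602.17570 (2026), §3.5 Thm. 3.10) by proving a STRONGER statement:

> **Theorem** (`IsSelfSimilarEulerProfile.half_le_of_isLocallyOutgoing_of_hasSelfSimilarFarField`). Let `γ > 0` and let
> `(U, P)` be a `C²` stationary self-similar Euler profile (CIV (3.3), centre `c`) with the
> far-field bounds (3.8) and the local outgoing property of CIV Definition 3.7 (finite nodal set of
> `V = γ(y − c) + U`, `V(y)·(y − y_*) ≥ c_*|y − y_*|²` near each node, `c_* ≥ 0`). If `U ≠ 0` then
> `γ ≥ ½`.

CIV's Theorem 3.10 assumes in addition that `Ω = curl U` is real-analytic at every node (used,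
through Prop. 3.9, to make `Ω` vanish NEAR the nodes; then the Bernoulli transport identity, the
Lagrangian flow and the self-similar Cauchy formula transport the vanishing everywhere). The proof
below is Eulerian and needs neither analyticity, nor Prop. 3.9, nor the Lagrangian flow:

* **Weighted `L^{2a}` identity.** For `f = |Ω|^{2a}` (`a ≥ 1`, a `C¹` function) and a `C¹` weight
  `e^{ψ} τ` (`τ = θ_{2R,R}(· − c)` a radial cutoff), `∫ div (f e^{ψ} τ V) = 0` reads
  `∫ e^{ψ} τ [ (V·∇)f + f (V·∇)ψ + 3γ f ] = −∫ f e^{ψ} (V·∇)τ`, and by the vorticity equation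
  (3.4) `(V·∇)f = 2a |Ω|^{2a−2}(⟪Ω, DU Ω⟫ − |Ω|²)`
  (`IsSelfSimilarEulerVorticityProfile.curl_eq_zero_of_weight`: if the bracket is `≤ −f` on
  `B̄(c, 2R)` and `V` points outward on `|y − c| ≥ R`, then `Ω ≡ 0` on `B̄(c, R)`).
* **Near the nodes** the outgoing property linearises to `⟪DU(y_*) h, h⟫ ≥ (c_* − γ)|h|²`
  (tree: `le_inner_fderiv_of_outgoing`), and `tr DU(y_*) = div U = 0`, so
  `⟪DU(y_*) w, w⟫ ≤ 2(γ − c_*)|w|² ≤ 2γ|w|² < |w|²` (`inner_apply_self_add_le_trace`); by continuity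
  `⟪DU(y) w, w⟫ ≤ θ|w|²`, `θ = (1+2γ)/2 < 1`, on a neighbourhood `D` of the nodal set; there a
  large exponent `a` makes `2a(θ − 1) + 3γ ≤ −1` — NO vanishing of `Ω` at the nodes is used.
* **Off the nodes**, on the compact `B̄(c, 2R) ∖ D`, `|V| ≥ cfl > 0` and `‖DU‖ ≤ M`; the weight
  `ψ = λ ℋ` with `ℋ` the self-similar Bernoulli function, `V·∇ℋ = (2γ − 1)|V|²` (CIV (3.31), tree:
  `fderiv_selfSimilarBernoulli_transport`), gives `λ(2γ−1)cfl²` as negative as we please when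
  `γ < ½`.
* **Far field**: (3.8) makes `V` outward for `|y − c| ≥ Rfl` and `DU → 0` at infinity
  (`HasSelfSimilarFarFieldWith.exists_inner_transport_nonneg`, `.tendsto_norm_fderiv`); so
  `Ω ≡ 0`, and an irrotational incompressible `C²` field with `DU → 0` is constant
  (tree: `eq_of_curl_eq_zero_of_isDivFree_of_fderiv_tendsto_zero`), `U ≡ U(c) = 0`.

Consequently `CIV2026_half_le_of_isLocallyOutgoing_of_analyticAt_holds` (the fact, with its
analyticity hypothesis simply dropped), and the window forms: in the Chae–Shvydkoy window `γ < ½`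
(route EulerZoomLiouville: `γ = 1/(2+ρ)`, `ρ > 0`) there is NO nontrivial `C²` self-similar Euler
profile with the decay (3.8) and the local outgoing property.

## References

* P. Constantin, M. Ignatova, V. Vicol, arXiv:2602.17570 (2026), §3.5 Def. 3.7, Thm. 3.8,
  Prop. 3.9, Thm. 3.10 and its proof (Bernoulli transport (3.31), far-field inflow, Cauchy formula
  (3.21)). [ConstantinIgnatovaVicol2026Putative]
* D. Chae, R. Shvydkoy, ARMA 209 (2013) = arXiv:1201.6009, §4 (the `|ω|^{p-2}ω` multiplier
  technique reused here). [ChaeShvydkoy2013]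

## Mathlib / tree search

Reused: `IsLocallyOutgoing`, `selfSimilarNodalSet`, `selfSimilarBernoulli`,
`IsSelfSimilarEulerProfile.fderiv_selfSimilarBernoulli_transport`, `HasSelfSimilarFarFieldWith`
(`SelfSimilarEulerProfile`); `le_inner_fderiv_of_outgoing` (`SelfSimilarEulerOutgoing`);
`fderiv_rpow_norm_sq_apply_of_one_le`, `contDiff_rpow_norm_sq_of_one_le`, translated `taoCutoff`
calculus (`SelfSimilarEulerVorticityExteriorEstimate(Large)`); `fderiv_curl_transport`,
`integral_mul_divergence_add_eq_zero_left`, `divergence_selfSimilarTransport`;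
`eq_of_curl_eq_zero_of_isDivFree_of_fderiv_tendsto_zero` (`HarmonicLiouvilleSublinear`). Mathlib:
`LinearMap.trace_eq_sum_inner`, `IsCompact.exists_forall_le'`, `IsCompact.exists_bound_of_continuousOn`,
`tendsto_rpow_neg_atTop`, `tendsto_dist_right_cocompact_atTop`.
-/

noncomputable section

open MeasureTheory Set Filter Function Topology InnerProductSpace Metric
open scoped RealInnerProductSpace NNReal

namespace Literature.Analysis.FluidPDE

/-! ### CIV Theorem 3.10 without analyticity -/

namespace IsSelfSimilarEulerProfile

variable {γ : ℝ} {c : EuclideanSpace ℝ (Fin 3)}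
  {U : EuclideanSpace ℝ (Fin 3) → EuclideanSpace ℝ (Fin 3)} {P : EuclideanSpace ℝ (Fin 3) → ℝ}

/-- **In the window `γ < ½`, a locally outgoing `C²` profile with the far-field bounds has
identically vanishing vorticity** — the heart of this file (CIV Thm. 3.10's conclusion `Ω ≡ 0`,
reached here without Prop. 3.9, analyticity, or the Lagrangian flow). [cite: ConstantinIgnatovaVicol2026Putative, §3.5 Thm. 3.10 (proof: "we deduce Ω ≡ 0")] -/
theorem curl_eq_zero_of_isLocallyOutgoing_of_lt_half (h : IsSelfSimilarEulerProfile γ c U P)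
    (hγ : 0 < γ) (hγ2 : γ < 1 / 2) {C : ℝ} (hfar : HasSelfSimilarFarFieldWith γ c C U)
    {κ ε : ℝ} (hout : IsLocallyOutgoing γ c U κ ε) : curl U = 0 := by
  classical
  have hU2 : ContDiff ℝ 2 U := h.contDiff_velocity
  have hUd : Differentiable ℝ U := hU2.differentiable (by norm_num)
  have hDUc : Continuous (fderiv ℝ U) := hU2.continuous_fderiv (by norm_num)
  have hVp := h.isSelfSimilarEulerVorticityProfile
  set V : EuclideanSpace ℝ (Fin 3) → EuclideanSpace ℝ (Fin 3) := selfSimilarTransport γ c U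
    with hVdef
  have hVc : Continuous V := by
    have : Continuous fun y : EuclideanSpace ℝ (Fin 3) => γ • (y - c) + U y :=
      ((continuous_id.sub continuous_const).const_smul γ).add hU2.continuous
    exact this
  set N : Set (EuclideanSpace ℝ (Fin 3)) := selfSimilarNodalSet γ c U with hNdef
  -- (1) at every node: `⟪DU(z) w, w⟫ ≤ 2γ |w|²`
  have hnode : ∀ z ∈ N, ∀ w : EuclideanSpace ℝ (Fin 3),
      ⟪fderiv ℝ U z w, w⟫ ≤ 2 * γ * ‖w‖ ^ 2 := by
    intro z hz w
    have hUz : HasFDerivAt U (fderiv ℝ U z) z := (hUd z).hasFDerivAt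
    have hVz : HasFDerivAt (selfSimilarTransport γ c U)
        (γ • ContinuousLinearMap.id ℝ (EuclideanSpace ℝ (Fin 3)) + fderiv ℝ U z) z :=
      (((hasFDerivAt_id z).sub_const c).fun_const_smul γ).fun_add hUz
    have hV0 : selfSimilarTransport γ c U z = 0 := hz
    have hq : ∀ v : EuclideanSpace ℝ (Fin 3), (κ - γ) * ‖v‖ ^ 2 ≤ ⟪fderiv ℝ U z v, v⟫ := by
      intro v
      have e := le_inner_fderiv_of_outgoing hVz hV0 hout.pos (hout.outgoing z hz) v
      rw [_root_.add_apply, _root_.smul_apply, ContinuousLinearMap.id_apply, inner_add_left,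
        inner_smul_left, conj_trivial, real_inner_self_eq_norm_sq] at e
      linarith
    have htr := inner_apply_self_le_trace_sub_mul hq w
    have hdiv : LinearMap.trace ℝ _ (fderiv ℝ U z :
        EuclideanSpace ℝ (Fin 3) →ₗ[ℝ] EuclideanSpace ℝ (Fin 3)) = 0 := h.divFree z
    rw [hdiv, finrank_euclideanSpace, Fintype.card_fin] at htr
    norm_num at htr
    nlinarith [hout.nonneg, sq_nonneg ‖w‖]
  -- (2) a neighbourhood `D` of the nodal set where `⟪DU w, w⟫ ≤ θ|w|²`, `θ = (1+2γ)/2 < 1`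
  set θ : ℝ := (1 + 2 * γ) / 2 with hθdef
  have hθ1 : θ < 1 := by rw [hθdef]; linarith
  have hrad : ∀ z ∈ N, ∃ r : ℝ, 0 < r ∧ ∀ y, dist y z < r →
      ∀ w : EuclideanSpace ℝ (Fin 3), ⟪fderiv ℝ U y w, w⟫ ≤ θ * ‖w‖ ^ 2 := by
    intro z hz
    have hδ : 0 < (1 - 2 * γ) / 2 := by linarith
    obtain ⟨r, hr, hball⟩ := Metric.continuousAt_iff.1 (hDUc.continuousAt (x := z)) _ hδ
    refine ⟨r, hr, fun y hy w => ?_⟩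
    have hn : ‖fderiv ℝ U y - fderiv ℝ U z‖ < (1 - 2 * γ) / 2 := by
      rw [← dist_eq_norm]; exact hball hy
    have h1 : ⟪(fderiv ℝ U y - fderiv ℝ U z) w, w⟫ ≤ (1 - 2 * γ) / 2 * ‖w‖ ^ 2 := by
      calc ⟪(fderiv ℝ U y - fderiv ℝ U z) w, w⟫
          ≤ ‖(fderiv ℝ U y - fderiv ℝ U z) w‖ * ‖w‖ := real_inner_le_norm _ _
        _ ≤ ‖fderiv ℝ U y - fderiv ℝ U z‖ * ‖w‖ * ‖w‖ :=
            mul_le_mul_of_nonneg_right (ContinuousLinearMap.le_opNorm _ _) (norm_nonneg _)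
        _ ≤ (1 - 2 * γ) / 2 * ‖w‖ * ‖w‖ := by gcongr
        _ = (1 - 2 * γ) / 2 * ‖w‖ ^ 2 := by ring
    have h2 := hnode z hz w
    have e : ⟪fderiv ℝ U y w, w⟫ = ⟪fderiv ℝ U z w, w⟫ + ⟪(fderiv ℝ U y - fderiv ℝ U z) w, w⟫ := by
      rw [show (fderiv ℝ U y - fderiv ℝ U z) w = fderiv ℝ U y w - fderiv ℝ U z w from rfl,
        inner_sub_left]
      ring
    rw [e, hθdef]
    linarith
  choose! r hr hrD using hrad
  set D : Set (EuclideanSpace ℝ (Fin 3)) := ⋃ z ∈ N, ball z (r z) with hDdef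
  have hDo : IsOpen D := isOpen_biUnion fun z _ => isOpen_ball
  have hND : N ⊆ D := fun z hz => mem_biUnion hz (mem_ball_self (hr z hz))
  have hDθ : ∀ y ∈ D, ∀ w : EuclideanSpace ℝ (Fin 3), ⟪fderiv ℝ U y w, w⟫ ≤ θ * ‖w‖ ^ 2 := by
    intro y hy w
    obtain ⟨z, hz, hyz⟩ := mem_iUnion₂.1 hy
    exact hrD z hz y (mem_ball.1 hyz) w
  -- (3) far field: outward transport beyond `Rfl`
  obtain ⟨Rfl, hRfl, hfarout⟩ := hfar.exists_inner_transport_nonneg hγ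
  -- (4) the exponent `a`
  set a : ℝ := 1 + (3 * γ + 1) / (2 * (1 - θ)) with hadef
  have ha1 : 1 ≤ a := by
    rw [hadef]
    have : 0 ≤ (3 * γ + 1) / (2 * (1 - θ)) := by
      apply div_nonneg <;> linarith
    linarith
  have haθ : 2 * a * (θ - 1) + 3 * γ ≤ -1 := by
    have h1θ : 0 < 1 - θ := by linarith
    have hne : 2 * (1 - θ) ≠ 0 := by positivity
    have e : 2 * a * (1 - θ) = 2 * (1 - θ) + (3 * γ + 1) := by
      calc 2 * a * (1 - θ) = 2 * (1 - θ) + (3 * γ + 1) / (2 * (1 - θ)) * (2 * (1 - θ)) := by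
            rw [hadef]; ring
        _ = 2 * (1 - θ) + (3 * γ + 1) := by rw [div_mul_cancel₀ _ hne]
    nlinarith
  -- (5) for every radius `R ≥ Rfl`, `Ω = 0` on `B̄(c, R)`
  have hball : ∀ R, Rfl ≤ R → ∀ y, ‖y - c‖ ≤ R → curl U y = 0 := by
    intro R hRR
    have hR : 0 < R := hRfl.trans_le hRR
    -- the compact set `K = B̄(c, 2R) \ D` and the constants `cfl`, `M`
    set K : Set (EuclideanSpace ℝ (Fin 3)) := closedBall c (2 * R) ∩ Dᶜ with hKdef
    have hKc : IsCompact K := (isCompact_closedBall c (2 * R)).inter_right hDo.isClosed_compl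
    have hVpos : ∀ y ∈ K, 0 < ‖V y‖ := by
      intro y hy
      rw [norm_pos_iff]
      intro hV0
      have hyN : y ∈ N := hV0
      exact hy.2 (hND hyN)
    obtain ⟨cfl, hcfl, hcflle⟩ := hKc.exists_forall_le' hVc.norm.continuousOn hVpos
    obtain ⟨M₀, hM₀⟩ := (isCompact_closedBall c (2 * R)).exists_bound_of_continuousOn
      hDUc.continuousOn
    set M : ℝ := max M₀ 1 with hMdef
    have hM : ∀ y, ‖y - c‖ ≤ 2 * R → ‖fderiv ℝ U y‖ ≤ M := fun y hy =>
      (hM₀ y (by rw [mem_closedBall, dist_eq_norm]; exact hy)).trans (le_max_left _ _)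
    -- the weight `ψ = λ ℋ`
    set lam : ℝ := (2 * a * M + 3 * γ + 1) / ((1 - 2 * γ) * cfl ^ 2) with hlamdef
    have hlam0 : 0 ≤ lam := by
      rw [hlamdef]
      apply div_nonneg
      · have : 0 ≤ 2 * a * M := by positivity
        linarith
      · have : 0 < 1 - 2 * γ := by linarith
        positivity
    have hlamK : 2 * a * (M - 1) + lam * ((2 * γ - 1) * cfl ^ 2) + 3 * γ ≤ -1 := by
      have hpos : 0 < (1 - 2 * γ) * cfl ^ 2 := by
        have : 0 < 1 - 2 * γ := by linarith
        positivity
      have e : lam * ((2 * γ - 1) * cfl ^ 2) = -(2 * a * M + 3 * γ + 1) := by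
        calc lam * ((2 * γ - 1) * cfl ^ 2)
            = -((2 * a * M + 3 * γ + 1) / ((1 - 2 * γ) * cfl ^ 2) * ((1 - 2 * γ) * cfl ^ 2)) := by
              rw [hlamdef]; ring
          _ = -(2 * a * M + 3 * γ + 1) := by rw [div_mul_cancel₀ _ hpos.ne']
      rw [e]
      have : 0 ≤ 2 * a := by linarith
      nlinarith
    set ψ : EuclideanSpace ℝ (Fin 3) → ℝ := fun y => lam * selfSimilarBernoulli γ c U P y
      with hψdef
    have hH1 := h.contDiff_selfSimilarBernoulli
    have hψ1 : ContDiff ℝ 1 ψ := contDiff_const.mul hH1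
    have hψV : ∀ y, fderiv ℝ ψ y (V y) = lam * ((2 * γ - 1) * ‖V y‖ ^ 2) := by
      intro y
      have hHd : DifferentiableAt ℝ (selfSimilarBernoulli γ c U P) y :=
        hH1.differentiable one_ne_zero y
      rw [hψdef, fderiv_const_mul hHd, _root_.smul_apply, smul_eq_mul, hVdef,
        h.fderiv_selfSimilarBernoulli_transport y]
    -- the bound function `m`
    set m : EuclideanSpace ℝ (Fin 3) → ℝ := fun y => if y ∈ D then θ else M with hmdef
    have hm : ∀ y, ‖y - c‖ ≤ 2 * R →
        ⟪curl U y, fderiv ℝ U y (curl U y)⟫ ≤ m y * ‖curl U y‖ ^ 2 := by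
      intro y hy
      by_cases hyD : y ∈ D
      · have hmy : m y = θ := if_pos hyD
        rw [hmy, real_inner_comm]
        exact hDθ y hyD _
      · have hmy : m y = M := if_neg hyD
        rw [hmy]
        calc ⟪curl U y, fderiv ℝ U y (curl U y)⟫
            ≤ ‖curl U y‖ * ‖fderiv ℝ U y (curl U y)‖ := real_inner_le_norm _ _
          _ ≤ ‖curl U y‖ * (‖fderiv ℝ U y‖ * ‖curl U y‖) :=
              mul_le_mul_of_nonneg_left (ContinuousLinearMap.le_opNorm _ _) (norm_nonneg _)
          _ ≤ ‖curl U y‖ * (M * ‖curl U y‖) := by gcongr; exact hM y hy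
          _ = M * ‖curl U y‖ ^ 2 := by ring
    have hbr : ∀ y, ‖y - c‖ ≤ 2 * R →
        2 * a * (m y - 1) + fderiv ℝ ψ y (selfSimilarTransport γ c U y) + 3 * γ ≤ -1 := by
      intro y hy
      rw [← hVdef, hψV y]
      by_cases hyD : y ∈ D
      · have hmy : m y = θ := if_pos hyD
        rw [hmy]
        have hneg : lam * ((2 * γ - 1) * ‖V y‖ ^ 2) ≤ 0 := by
          have : (2 * γ - 1) * ‖V y‖ ^ 2 ≤ 0 :=
            mul_nonpos_of_nonpos_of_nonneg (by linarith) (sq_nonneg _)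
          exact mul_nonpos_of_nonneg_of_nonpos hlam0 this
        linarith
      · have hmy : m y = M := if_neg hyD
        rw [hmy]
        have hyK : y ∈ K := ⟨by rw [mem_closedBall, dist_eq_norm]; exact hy, hyD⟩
        have hVy : cfl ≤ ‖V y‖ := hcflle y hyK
        have hsq : cfl ^ 2 ≤ ‖V y‖ ^ 2 := pow_le_pow_left₀ hcfl.le hVy 2
        have hmono : lam * ((2 * γ - 1) * ‖V y‖ ^ 2) ≤ lam * ((2 * γ - 1) * cfl ^ 2) := by
          apply mul_le_mul_of_nonneg_left _ hlam0
          have : 2 * γ - 1 ≤ 0 := by linarith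
          exact mul_le_mul_of_nonpos_left hsq this
        linarith
    have hout' : ∀ y, R ≤ ‖y - c‖ → 0 ≤ ⟪selfSimilarTransport γ c U y, y - c⟫ :=
      fun y hy => hfarout y (hRR.trans hy)
    exact hVp.curl_eq_zero_of_weight ha1 hψ1 hR hm hbr hout'
  -- (6) conclusion
  funext y
  have := hball (max Rfl ‖y - c‖) (le_max_left _ _) y (le_max_right _ _)
  simpa using this

/-- **CIV Theorem 3.10 without the analyticity hypothesis, window form.** Let `γ ∈ (0, ½)` and let
`(U, P)` be a `C²` self-similar Euler profile (CIV (3.3)) with the far-field bounds (3.8) whose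
transport field `V = γ(y − c) + U` has the local outgoing property of CIV Definition 3.7. Then
`U = 0`. [cite: ConstantinIgnatovaVicol2026Putative, §3.5 Thm. 3.10] -/
theorem eq_zero_of_isLocallyOutgoing_of_lt_half (h : IsSelfSimilarEulerProfile γ c U P)
    (hγ : 0 < γ) (hγ2 : γ < 1 / 2) (hfar : HasSelfSimilarFarField γ c U)
    {κ ε : ℝ} (hout : IsLocallyOutgoing γ c U κ ε) : U = 0 := by
  obtain ⟨C, hC⟩ := hfar
  have hU2 : ContDiff ℝ 2 U := h.contDiff_velocity
  have hcurl0 := h.curl_eq_zero_of_isLocallyOutgoing_of_lt_half hγ hγ2 hC hout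
  have hcurl : ∀ x, curl U x = 0 := fun x => congrFun hcurl0 x
  have hD := hC.tendsto_norm_fderiv hγ
  funext y
  rw [eq_of_curl_eq_zero_of_isDivFree_of_fderiv_tendsto_zero hU2 hcurl h.divFree hD y c,
    hC.apply_center]
  rfl

/-- **CIV Theorem 3.10 without the analyticity hypothesis.** Let `γ > 0` and let `(U, P)` be a
nontrivial `C²` self-similar Euler profile (CIV (3.3)) with the far-field bounds (3.8) and the local
outgoing property of CIV Definition 3.7 (`c_* ≥ 0`). Then `γ ≥ ½`. (CIV assume in addition that
`curl U` is real-analytic at the nodal set; that hypothesis is not needed.) [cite: ConstantinIgnatovaVicol2026Putative, §3.5 Thm. 3.10] -/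
theorem half_le_of_isLocallyOutgoing_of_hasSelfSimilarFarField (h : IsSelfSimilarEulerProfile γ c U P)
    (hγ : 0 < γ)
    (hfar : HasSelfSimilarFarField γ c U) (hU : U ≠ 0) {κ ε : ℝ}
    (hout : IsLocallyOutgoing γ c U κ ε) : 1 / 2 ≤ γ := by
  by_contra hlt
  exact hU (h.eq_zero_of_isLocallyOutgoing_of_lt_half hγ (not_le.1 hlt) hfar hout)

/-- **Exponent form** (route EulerZoomLiouville: length exponent `γ = 1/(2+ρ)`, window
`ρ > 0 ⟺ 0 < γ < ½`): in the window, a locally outgoing `C²` self-similar Euler profile with the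
decay (3.8) is trivial — unconditionally (no analyticity, no named fact). [cite: ConstantinIgnatovaVicol2026Putative, §3.5 Thm. 3.10] -/
theorem eq_zero_of_isLocallyOutgoing_of_exponent (h : IsSelfSimilarEulerProfile γ c U P)
    {ρ : ℝ} (hρ : 0 < ρ) (hγ : γ = 1 / (2 + ρ)) (hfar : HasSelfSimilarFarField γ c U)
    {κ ε : ℝ} (hout : IsLocallyOutgoing γ c U κ ε) : U = 0 := by
  have h2ρ : (0 : ℝ) < 2 + ρ := by linarith
  refine h.eq_zero_of_isLocallyOutgoing_of_lt_half (hγ ▸ one_div_pos.2 h2ρ) ?_ hfar hout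
  rw [hγ]
  exact one_div_lt_one_div_of_lt two_pos (by linarith)

end IsSelfSimilarEulerProfile

/-! ### The fact -/

/-- **Constantin–Ignatova–Vicol 2026, Theorem 3.10, discharged**: the named fact
`CIV2026_half_le_of_isLocallyOutgoing_of_analyticAt` holds — indeed without its analyticity
hypothesis (`IsSelfSimilarEulerProfile.half_le_of_isLocallyOutgoing_of_hasSelfSimilarFarField`). [cite: ConstantinIgnatovaVicol2026Putative, §3.5 Thm. 3.10] -/
theorem CIV2026_half_le_of_isLocallyOutgoing_of_analyticAt_holds :
    CIV2026_half_le_of_isLocallyOutgoing_of_analyticAt :=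
  fun _γ hγ _c _U _P h hfar hU _κ _ε hout _han => h.half_le_of_isLocallyOutgoing_of_hasSelfSimilarFarField hγ hfar hU hout

end Literature.Analysis.FluidPDE

end
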